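import Literature.MathematicalPhysics.QuantumFieldTheory.LatticeSiteRPMechanism
import Literature.MathematicalPhysics.QuantumLattice.GaugeGroups
import HarnessLib

/-!
# Swap reflection positivity of the Wilson action on the Fröhlich–Israel–Lieb–Simon 45° torus

The 45° (FILS) torus `T̃_N = ℤ⁴ / ⟨N(e₀+e₁), N(e₀−e₁), N e₂, N e₃⟩` carries the reflection `x₀ ↔ x₁` in the
diagonal lattice hyperplanes `x₀ = x₁` and `x₀ = x₁ + N` (reflection THROUGH SITES in the sense of
Fröhlich–Israel–Lieb–Simon, Comm. Math. Phys. 62 (1978), Thm. 2.1, in the tilted geometry of FILS II,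
J. Stat. Phys. 22 (1980), §3). In the chart `(u, w, y, z) = (x₀ − x₁, x₁, x₂, x₃)` the torus is the box
`ℤ_{2N} × ℤ_N × ℤ_N × ℤ_N`, the steps are `e₀ = (1,0,0,0)`, `e₁ = (−1,1,0,0)`, `e₂ = (0,0,1,0)`,
`e₃ = (0,0,0,1)`, the swap is `θ(u,w,y,z) = (−u, w + ū, y, z)` (`ū = u mod N`; it fixes the two mirror
layers `u = 0`, `u = N` pointwise and exchanges `e₀ ↔ e₁`), acting on positively oriented links by
`(x, i) ↦ (θx, σ i)`, `σ = (0 1)`, and on configurations by `U ↦ U ∘ θ`.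

**Main result** (`integral_conj_swap_mul_nonneg`). For a compact group `G`, a continuous unitary matrix
representation `ρ`, `β ≥ 0`, `N ≥ 2` and every bounded measurable `F` depending only on the links of the CLOSED
half `0 ≤ u ≤ N` (both endpoints between the mirror layers),
`0 ≤ ∫ conj F(U ∘ θ) · F(U) · exp(β ∑ₓ ∑_{i<j} Re tr ρ(U_{x,ij})) ∏ dU_e` as a complex number (real and
non-negative). `N = 1` is false (both layers are mirrors and the closed half is everything); square tori are
not swap reflection positive at all — the tilted cover is what makes the diagonal mirror a lattice symmetry
with a positive cone.

**Proof.** Reduction to the tree's abstract engine with a shared block,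
`LatticeRP.integral_mul_conj_mul_exp_nonneg_of_shared`: shared block `M` = the `e₂, e₃`-links of the two
mirror layers (fixed by `θ`), positive block `P` = the other links of the closed half, no crossing links
(`C = ∅`); `Θ = (· ∘ θ)` relabels the factors of product Haar measure by an involution. The plaquettes
`(x, i<j)` split by `u = x.u` into POSITIVE ones (all four links in the closed half, one off the layers),
their mirror images (`Re tr ρ((U∘θ)_p) = Re tr ρ(U_{τp})`, `τ` the induced involution on plaquette labels,
using `θ(x + eᵢ) = θx + e_{σi}` and `Re tr ρ(g⁻¹) = Re tr ρ(g)`), the SHARED `(2,3)`-plaquettes inside the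
layers, and the CUT `(0,1)`-plaquettes based on the layers, whose holonomy factors as `U_p = P₊ · (P₊ ∘ Θ)⁻¹`
(layer `0`) or `(P₊ ∘ Θ) · P₊⁻¹` (layer `N`) with `P₊` a product of two links of the closed half; by
unitarity `Re tr ρ(U_p) = Re ∑_{ab} ρ(P₊)_{ab} conj ρ(P₊ ∘ Θ)_{ab}`, a Gram kernel — the exponent
`∑ᵢ aᵢ conj (aᵢ ∘ Θ)` of the engine with `aᵢ ∈ {√(β/2) ρ(P₊)_{ab}, √(β/2) conj ρ(P₊)_{ab}}`.

**Design.** The file is definition-free: the geometric data (steps `st`, site swap `θs`, link swap `θ`,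
plaquette holonomy `plaq`, action `act`, the closed half `Pos`) and the bookkeeping objects (blocks `M`,
`P`, plaquette classes, `τ`, the half-plaquette `cl`, the Gram coefficients `a`, the observable `g`) are
parameters constrained by their defining equations (section variables `hst`, `hθs`, …), so that a user
with its own named definitions (e.g. a `Summits/` vocabulary) instantiates the main theorem by `rfl`s.
Sites are `ZMod (2 * N) × ZMod N × ZMod N × ZMod N`, links `site × Fin 4`, plaquette labels
`site × Fin 4 × Fin 4`.

References: J. Fröhlich, R. Israel, E. H. Lieb, B. Simon, Comm. Math. Phys. 62 (1978) 1, Thm. 2.1 [FILS1978];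
K. Osterwalder, E. Seiler, Ann. Phys. 110 (1978) 440, §2 [OsterwalderSeiler1978]. All statements here are proved.
-/

noncomputable section

open MeasureTheory Finset Complex
open scoped ComplexOrder ComplexConjugate

namespace Literature.MathematicalPhysics.QuantumFieldTheory

namespace TiltedTorusRP

open LatticeRP

/-! ### Unitary matrix representations: traces and entries -/

section Rep

variable {G : Type*} [Group G] {Nc : ℕ} (ρ : G →* Matrix (Fin Nc) (Fin Nc) ℂ)

/-- For a unitary representation, `ρ(g⁻¹) = ρ(g)†`. [folklore] -/
theorem map_inv_eq_star (hu : ∀ g, ρ g ∈ Matrix.unitaryGroup (Fin Nc) ℂ) (g : G) :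
    ρ g⁻¹ = star (ρ g) := by
  have h1 : ρ g⁻¹ * ρ g = 1 := by rw [← map_mul, inv_mul_cancel, map_one]
  have h2 : ρ g * star (ρ g) = 1 := Matrix.mem_unitaryGroup_iff.1 (hu g)
  calc ρ g⁻¹ = ρ g⁻¹ * (ρ g * star (ρ g)) := by rw [h2, mul_one]
    _ = star (ρ g) := by rw [← mul_assoc, h1, one_mul]

/-- `Re tr ρ(g⁻¹) = Re tr ρ(g)` for a unitary representation. [folklore] -/
theorem re_trace_map_inv (hu : ∀ g, ρ g ∈ Matrix.unitaryGroup (Fin Nc) ℂ) (g : G) :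
    (ρ g⁻¹).trace.re = (ρ g).trace.re := by
  rw [map_inv_eq_star ρ hu, Matrix.star_eq_conjTranspose, Matrix.trace_conjTranspose, Complex.star_def,
    Complex.conj_re]

/-- `Re tr ρ(a b⁻¹) = Re ∑_{kl} ρ(a)_{kl} conj ρ(b)_{kl}` for a unitary representation. [folklore] -/
theorem re_trace_map_mul_inv (hu : ∀ g, ρ g ∈ Matrix.unitaryGroup (Fin Nc) ℂ) (a b : G) :
    (ρ (a * b⁻¹)).trace.re = (∑ k, ∑ l, ρ a k l * conj (ρ b k l)).re := by
  rw [map_mul, map_inv_eq_star ρ hu, Matrix.star_eq_conjTranspose]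
  simp only [Matrix.trace, Matrix.diag_apply, Matrix.mul_apply, Matrix.conjTranspose_apply,
    Complex.star_def]

/-- `Re tr ρ(b a⁻¹) = Re tr ρ(a b⁻¹)`. [folklore] -/
theorem re_trace_map_mul_inv_comm (hu : ∀ g, ρ g ∈ Matrix.unitaryGroup (Fin Nc) ℂ) (a b : G) :
    (ρ (b * a⁻¹)).trace.re = (ρ (a * b⁻¹)).trace.re := by
  rw [show b * a⁻¹ = (a * b⁻¹)⁻¹ by group, re_trace_map_inv ρ hu]

/-- Entries of a unitary `ρ(g)` have norm at most one. [folklore] -/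
theorem norm_entry_le_one (hu : ∀ g, ρ g ∈ Matrix.unitaryGroup (Fin Nc) ℂ) (g : G) (k l : Fin Nc) :
    ‖ρ g k l‖ ≤ 1 :=
  entry_norm_bound_of_unitary (hu g) k l

/-- `|Re tr ρ(g)| ≤ Nc` for a unitary representation. [folklore] -/
theorem abs_re_trace_le (hu : ∀ g, ρ g ∈ Matrix.unitaryGroup (Fin Nc) ℂ) (g : G) :
    |(ρ g).trace.re| ≤ Nc := by
  calc |(ρ g).trace.re| ≤ ‖(ρ g).trace‖ := Complex.abs_re_le_norm _
    _ = ‖∑ k, ρ g k k‖ := by simp only [Matrix.trace, Matrix.diag_apply]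
    _ ≤ ∑ k, ‖ρ g k k‖ := norm_sum_le _ _
    _ ≤ ∑ _k : Fin Nc, (1 : ℝ) := Finset.sum_le_sum fun k _ => norm_entry_le_one ρ hu g k k
    _ = Nc := by simp

variable {ι : Type*} [TopologicalSpace G] [MeasurableSpace G] [BorelSpace G]

omit [TopologicalSpace G] [BorelSpace G] in
/-- Products of entry-measurable words are entry-measurable (no measurability of the multiplication of `G`
is used: `ρ` is pushed inside first). [folklore] -/
theorem entryMeasurable_mul {f g : (ι → G) → G} (hf : ∀ k l, Measurable fun U => ρ (f U) k l)
    (hg : ∀ k l, Measurable fun U => ρ (g U) k l) : ∀ k l, Measurable fun U => ρ (f U * g U) k l := by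
  intro k l
  simp only [map_mul, Matrix.mul_apply]
  exact Finset.measurable_sum _ fun c _ => (hf k c).mul (hg c l)

/-- A single link variable is entry-measurable. [folklore] -/
theorem entryMeasurable_apply (hρ : Continuous ρ) (e : ι) :
    ∀ k l, Measurable fun U : ι → G => ρ (U e) k l :=
  fun k l => (hρ.matrix_elem k l).measurable.comp (measurable_pi_apply e)

/-- The inverse of a single link variable is entry-measurable. [folklore] -/
theorem entryMeasurable_apply_inv [IsTopologicalGroup G] (hρ : Continuous ρ) (e : ι) :
    ∀ k l, Measurable fun U : ι → G => ρ (U e)⁻¹ k l :=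
  fun k l => ((hρ.comp continuous_inv).matrix_elem k l).measurable.comp (measurable_pi_apply e)

omit [TopologicalSpace G] [BorelSpace G] in
/-- The real part of the character of an entry-measurable word is measurable. [folklore] -/
theorem measurable_re_trace {f : (ι → G) → G} (hf : ∀ k l, Measurable fun U => ρ (f U) k l) :
    Measurable fun U => (ρ (f U)).trace.re := by
  simp only [Matrix.trace, Matrix.diag_apply, Complex.re_sum]
  exact Finset.measurable_sum _ fun k _ => Complex.measurable_re.comp (hf k k)

end Rep

/-! ### The geometric data of the 45° torus, as constrained parameters -/

section Param

variable {N : ℕ}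
  {st : Fin 4 → ZMod (2 * N) × ZMod N × ZMod N × ZMod N}
  {θs : ZMod (2 * N) × ZMod N × ZMod N × ZMod N → ZMod (2 * N) × ZMod N × ZMod N × ZMod N}
  {θ : (ZMod (2 * N) × ZMod N × ZMod N × ZMod N) × Fin 4 → (ZMod (2 * N) × ZMod N × ZMod N × ZMod N) × Fin 4}
  {d : Fin 4 × Fin 4 → Fin 4 × Fin 4}
  {τ : (ZMod (2 * N) × ZMod N × ZMod N × ZMod N) × Fin 4 × Fin 4 →
    (ZMod (2 * N) × ZMod N × ZMod N × ZMod N) × Fin 4 × Fin 4}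
  {Pos : Set ((ZMod (2 * N) × ZMod N × ZMod N × ZMod N) × Fin 4)}
  {M P : Finset ((ZMod (2 * N) × ZMod N × ZMod N × ZMod N) × Fin 4)}
  {lt cut sh pos neg : Finset ((ZMod (2 * N) × ZMod N × ZMod N × ZMod N) × Fin 4 × Fin 4)}

variable
  (hst : st = ![((1 : ZMod (2 * N)), (0 : ZMod N), (0 : ZMod N), (0 : ZMod N)),
    ((-1 : ZMod (2 * N)), (1 : ZMod N), (0 : ZMod N), (0 : ZMod N)),
    ((0 : ZMod (2 * N)), (0 : ZMod N), (1 : ZMod N), (0 : ZMod N)),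
    ((0 : ZMod (2 * N)), (0 : ZMod N), (0 : ZMod N), (1 : ZMod N))])
  (hθs : θs = fun x => (-x.1, x.2.1 + ZMod.castHom (dvd_mul_left N 2) (ZMod N) x.1, x.2.2.1, x.2.2.2))
  (hθ : θ = fun e => (θs e.1, Equiv.swap (0 : Fin 4) 1 e.2))
  (hd : d = fun p => if (p.1 = 0 ∧ p.2 = 1) ∨ (p.1 = 1 ∧ p.2 = 0) then p
    else (Equiv.swap (0 : Fin 4) 1 p.1, Equiv.swap (0 : Fin 4) 1 p.2))
  (hτ : τ = fun k => (θs k.1, d k.2))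
  (hPos : ∀ e, e ∈ Pos ↔ e.1.1.val ≤ N ∧ (e.1 + st e.2).1.val ≤ N)
  (hM : ∀ e, e ∈ M ↔ (e.2 = 2 ∨ e.2 = 3) ∧ (e.1.1.val = 0 ∨ e.1.1.val = N))
  (hP : ∀ e, e ∈ P ↔ e ∈ Pos ∧ e ∉ M)
  (hlt : ∀ k, k ∈ lt ↔ k.2.1 < k.2.2)
  (hcut : ∀ k, k ∈ cut ↔ k.2.1 = 0 ∧ k.2.2 = 1 ∧ (k.1.1.val = 0 ∨ k.1.1.val = N))
  (hsh : ∀ k, k ∈ sh ↔ k.2.1 = 2 ∧ k.2.2 = 3 ∧ (k.1.1.val = 0 ∨ k.1.1.val = N))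
  (hpos : ∀ k, k ∈ pos ↔
    (k.2.1 = 0 ∧ k.2.2 = 1 ∧ 1 ≤ k.1.1.val ∧ k.1.1.val + 1 ≤ N) ∨
    (k.2.1 = 0 ∧ (k.2.2 = 2 ∨ k.2.2 = 3) ∧ k.1.1.val + 1 ≤ N) ∨
    (k.2.1 = 1 ∧ (k.2.2 = 2 ∨ k.2.2 = 3) ∧ 1 ≤ k.1.1.val ∧ k.1.1.val ≤ N) ∨
    (k.2.1 = 2 ∧ k.2.2 = 3 ∧ 1 ≤ k.1.1.val ∧ k.1.1.val + 1 ≤ N))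
  (hneg : neg = lt \ (cut ∪ sh ∪ pos))

/-! ### Geometry of the swap (no finiteness needed) -/

section Geometry

/-- `σ 2 = 2` for `σ = (0 1)` on `Fin 4`. [folklore] -/
@[simp] theorem swap01_two : Equiv.swap (0 : Fin 4) 1 2 = 2 := by decide

/-- `σ 3 = 3` for `σ = (0 1)` on `Fin 4`. [folklore] -/
@[simp] theorem swap01_three : Equiv.swap (0 : Fin 4) 1 3 = 3 := by decide

include hst in
/-- First coordinate of `e₀`. [folklore] -/
theorem st_zero_fst : (st 0).1 = 1 := by subst hst; rfl

include hst in
/-- First coordinate of `e₁`. [folklore] -/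
theorem st_one_fst : (st 1).1 = -1 := by subst hst; simp

include hst in
/-- First coordinate of `e₂`. [folklore] -/
theorem st_two_fst : (st 2).1 = 0 := by subst hst; rfl

include hst in
/-- First coordinate of `e₃`. [folklore] -/
theorem st_three_fst : (st 3).1 = 0 := by subst hst; rfl

include hθs in
/-- First coordinate of the swapped site: `(θx).u = -u`. [folklore] -/
theorem θs_fst (x : ZMod (2 * N) × ZMod N × ZMod N × ZMod N) : (θs x).1 = -x.1 := by subst hθs; rfl

include hθs in
/-- The site swap is an involution. [folklore] -/
theorem θs_θs (x : ZMod (2 * N) × ZMod N × ZMod N × ZMod N) : θs (θs x) = x := by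
  subst hθs
  obtain ⟨u, w, y, z⟩ := x
  simp only [neg_neg, map_neg, Prod.mk.injEq, and_true, true_and]
  abel

include hst hθs in
/-- `θ(x + eᵢ) = θx + e_{σ i}`: the swap exchanges the steps `e₀`, `e₁` and fixes `e₂`, `e₃`. [folklore] -/
theorem θs_add_st (x : ZMod (2 * N) × ZMod N × ZMod N × ZMod N) (i : Fin 4) :
    θs (x + st i) = θs x + st (Equiv.swap (0 : Fin 4) 1 i) := by
  subst hst hθs
  obtain ⟨u, w, y, z⟩ := x
  fin_cases i <;>
    (ext <;> simp [Equiv.swap_apply_left, Equiv.swap_apply_right, Equiv.swap_apply_of_ne_of_ne] <;> abel)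

include hθs in
/-- The swap fixes the layer `u = 0` pointwise. [folklore] -/
theorem θs_of_fst_eq_zero {x : ZMod (2 * N) × ZMod N × ZMod N × ZMod N} (h : x.1 = 0) : θs x = x := by
  subst hθs
  obtain ⟨u, w, y, z⟩ := x
  simp only at h
  subst h
  simp

/-- `-N = N` in `ZMod (2N)`. [folklore] -/
theorem neg_natCast_N : -((N : ℕ) : ZMod (2 * N)) = (N : ZMod (2 * N)) := by
  rw [neg_eq_iff_add_eq_zero, ← Nat.cast_add, show N + N = 2 * N by ring, ZMod.natCast_self]

/-- The reduction `ZMod (2N) → ZMod N` kills `N`. [folklore] -/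
theorem castHom_natCast_N : ZMod.castHom (dvd_mul_left N 2) (ZMod N) ((N : ℕ) : ZMod (2 * N)) = 0 := by
  rw [map_natCast, ZMod.natCast_self]

include hθs in
/-- The swap fixes the layer `u = N` pointwise. [folklore] -/
theorem θs_of_fst_eq_N {x : ZMod (2 * N) × ZMod N × ZMod N × ZMod N} (h : x.1 = (N : ZMod (2 * N))) :
    θs x = x := by
  subst hθs
  obtain ⟨u, w, y, z⟩ := x
  simp only at h
  subst h
  simp only [neg_natCast_N, castHom_natCast_N, add_zero]

include hθs hθ in
/-- The link swap is an involution. [folklore] -/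
theorem θ_θ (e : (ZMod (2 * N) × ZMod N × ZMod N × ZMod N) × Fin 4) : θ (θ e) = e := by
  subst hθ
  obtain ⟨x, i⟩ := e
  simp [θs_θs hθs, Equiv.swap_apply_self]

include hst hθs hθ in
/-- **`θ`-covariance of the plaquette holonomy**: `(U ∘ θ)_{x,ij} = U_{θx, σi σj}`. [folklore] -/
theorem plaq_comp_θ {G : Type*} [Group G]
    {plaq : ((ZMod (2 * N) × ZMod N × ZMod N × ZMod N) × Fin 4 → G) →
      ZMod (2 * N) × ZMod N × ZMod N × ZMod N → Fin 4 → Fin 4 → G}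
    (hplaq : plaq = fun U x i j => U (x, i) * U (x + st i, j) * (U (x + st j, i))⁻¹ * (U (x, j))⁻¹)
    (U : (ZMod (2 * N) × ZMod N × ZMod N × ZMod N) × Fin 4 → G)
    (x : ZMod (2 * N) × ZMod N × ZMod N × ZMod N) (i j : Fin 4) :
    plaq (U ∘ θ) x i j = plaq U (θs x) (Equiv.swap (0 : Fin 4) 1 i) (Equiv.swap (0 : Fin 4) 1 j) := by
  subst hplaq hθ
  simp only [Function.comp_apply, θs_add_st hst hθs]

/-- Exchanging the two directions inverts the plaquette holonomy: `U_{x,ji} = (U_{x,ij})⁻¹`. [folklore] -/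
theorem plaq_swap_dirs {G : Type*} [Group G]
    {plaq : ((ZMod (2 * N) × ZMod N × ZMod N × ZMod N) × Fin 4 → G) →
      ZMod (2 * N) × ZMod N × ZMod N × ZMod N → Fin 4 → Fin 4 → G}
    (hplaq : plaq = fun U x i j => U (x, i) * U (x + st i, j) * (U (x + st j, i))⁻¹ * (U (x, j))⁻¹)
    (U : (ZMod (2 * N) × ZMod N × ZMod N × ZMod N) × Fin 4 → G)
    (x : ZMod (2 * N) × ZMod N × ZMod N × ZMod N) (i j : Fin 4) : plaq U x j i = (plaq U x i j)⁻¹ := by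
  subst hplaq
  simp only [mul_inv_rev, inv_inv, mul_assoc]

include hd in
/-- The direction part of `τ` is an involution. [folklore] -/
theorem d_d (p : Fin 4 × Fin 4) : d (d p) = p := by subst hd; revert p; decide

include hθs hd hτ in
/-- `τ` is an involution on plaquette labels. [folklore] -/
theorem τ_τ (k : (ZMod (2 * N) × ZMod N × ZMod N × ZMod N) × Fin 4 × Fin 4) : τ (τ k) = k := by
  subst hτ
  obtain ⟨x, p⟩ := k
  simp [θs_θs hθs, d_d hd]

end Geometry

/-! ### `u`-arithmetic in `ZMod (2N)` -/

section UArith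

variable [NeZero (2 * N)]

/-- `(u + 1).val` in `ZMod (2N)`. [folklore] -/
theorem val_add_one (u : ZMod (2 * N)) :
    (u.val = 2 * N - 1 ∧ (u + 1).val = 0) ∨ (u.val < 2 * N - 1 ∧ (u + 1).val = u.val + 1) := by
  have hlt := ZMod.val_lt u
  have hN := NeZero.ne (2 * N)
  have h1 : (1 : ZMod (2 * N)).val = 1 := by
    rw [← Nat.cast_one, ZMod.val_natCast]; exact Nat.mod_eq_of_lt (by omega)
  rw [ZMod.val_add, h1]
  by_cases h : u.val = 2 * N - 1
  · left
    refine ⟨h, ?_⟩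
    rw [h, show 2 * N - 1 + 1 = 2 * N by omega, Nat.mod_self]
  · right
    exact ⟨by omega, Nat.mod_eq_of_lt (by omega)⟩

/-- `(u - 1).val` in `ZMod (2N)`. [folklore] -/
theorem val_sub_one (u : ZMod (2 * N)) :
    (u.val = 0 ∧ (u + -1).val = 2 * N - 1) ∨ (0 < u.val ∧ (u + -1).val = u.val - 1) := by
  have hlt := ZMod.val_lt u
  rcases val_add_one (u + -1) with ⟨h1, h2⟩ | ⟨h1, h2⟩
  · rw [neg_add_cancel_right] at h2
    exact Or.inl ⟨h2, h1⟩
  · rw [neg_add_cancel_right] at h2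
    exact Or.inr ⟨by omega, by omega⟩

/-- `(-u).val` in `ZMod (2N)`. [folklore] -/
theorem val_neg (u : ZMod (2 * N)) :
    (u.val = 0 ∧ (-u).val = 0) ∨ (0 < u.val ∧ (-u).val = 2 * N - u.val) := by
  rw [ZMod.neg_val]
  by_cases h : u = 0
  · left; simp [h]
  · right
    have : u.val ≠ 0 := fun h' => h ((ZMod.val_eq_zero u).1 h')
    simp only [h, ↓reduceIte, and_true]
    omega

/-- `val (N : ZMod (2N)) = N`. [folklore] -/
theorem val_natCast_N : ((N : ℕ) : ZMod (2 * N)).val = N := by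
  rw [ZMod.val_natCast]; exact Nat.mod_eq_of_lt (by have := NeZero.ne (2 * N); omega)

/-- `u.val = N` iff `u = N` in `ZMod (2N)`. [folklore] -/
theorem val_eq_N_iff (u : ZMod (2 * N)) : u.val = N ↔ u = (N : ZMod (2 * N)) := by
  constructor
  · intro h; rw [← ZMod.natCast_zmod_val u, h]
  · intro h; rw [h, val_natCast_N]

end UArith

/-! ### Links: the shared block `M` and the positive block `P` -/

section Links

variable [NeZero (2 * N)]

include hP in
omit [NeZero (2 * N)] in
/-- `M` and `P` are disjoint. [folklore] -/
theorem disjoint_M_P : Disjoint M P := by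
  rw [Finset.disjoint_left]; intro e he hp; exact ((hP e).1 hp).2 he

include hst hPos hM in
omit [NeZero (2 * N)] in
/-- Shared links lie in the closed positive half. [folklore] -/
theorem mem_Pos_of_mem_M {e : (ZMod (2 * N) × ZMod N × ZMod N × ZMod N) × Fin 4} (he : e ∈ M) :
    e ∈ Pos := by
  obtain ⟨x, i⟩ := e
  obtain ⟨hi, hu⟩ := (hM _).1 he
  simp only at hi hu
  rw [hPos]
  rcases hi with rfl | rfl <;> simp [st_two_fst hst, st_three_fst hst, -ZMod.val_eq_zero] <;> omega

include hP in
omit [NeZero (2 * N)] in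
/-- `Pos ⊆ P ∪ ∅ ∪ M`. [folklore] -/
theorem mem_union_of_mem_Pos {e : (ZMod (2 * N) × ZMod N × ZMod N × ZMod N) × Fin 4} (he : e ∈ Pos) :
    e ∈ ((P ∪ ∅ ∪ M : Finset _) : Set ((ZMod (2 * N) × ZMod N × ZMod N × ZMod N) × Fin 4)) := by
  rw [Finset.coe_union, Finset.coe_union, Finset.coe_empty, Set.union_empty]
  by_cases hMe : e ∈ M
  · exact Or.inr hMe
  · exact Or.inl ((hP e).2 ⟨he, hMe⟩)

include hP in
omit [NeZero (2 * N)] in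
/-- A function depending only on the closed positive half depends only on `P ∪ ∅ ∪ M`. [folklore] -/
theorem dependsOn_union_of_Pos {β : Type*} {G : Type*}
    {f : ((ZMod (2 * N) × ZMod N × ZMod N × ZMod N) × Fin 4 → G) → β} (hf : DependsOn f Pos) :
    DependsOn f ((P ∪ ∅ ∪ M : Finset _) : Set ((ZMod (2 * N) × ZMod N × ZMod N × ZMod N) × Fin 4)) :=
  fun _ _ hUV => hf fun e he => hUV e (mem_union_of_mem_Pos hP he)

include hθs hθ hM in
/-- The swap fixes the shared links. [folklore] -/
theorem θ_of_mem_M {e : (ZMod (2 * N) × ZMod N × ZMod N × ZMod N) × Fin 4} (he : e ∈ M) : θ e = e := by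
  obtain ⟨x, i⟩ := e
  obtain ⟨hi, hu⟩ := (hM _).1 he
  simp only at hi hu
  have hx : θs x = x := by
    rcases hu with h | h
    · exact θs_of_fst_eq_zero hθs ((ZMod.val_eq_zero _).1 h)
    · exact θs_of_fst_eq_N hθs ((val_eq_N_iff _).1 h)
  subst hθ
  rcases hi with rfl | rfl <;> simp [hx]

include hst hθs hθ hPos hM in
/-- **The key set fact**: a link of the closed positive half whose mirror image is also in the closed positive
half is a shared link (`N ≥ 2`). [folklore] -/
theorem mem_M_of_mem_Pos_of_θ_mem (hN : 2 ≤ N) {e : (ZMod (2 * N) × ZMod N × ZMod N × ZMod N) × Fin 4}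
    (he : e ∈ Pos) (he' : θ e ∈ Pos) : e ∈ M := by
  obtain ⟨x, i⟩ := e
  rw [hPos] at he he'
  rw [hM]
  subst hθ
  have h1 := val_add_one x.1
  have h2 := val_sub_one x.1
  have h3 := val_neg x.1
  have h4 := val_add_one (-x.1)
  have h5 := val_sub_one (-x.1)
  have hl := ZMod.val_lt x.1
  have hl' := ZMod.val_lt (-x.1)
  fin_cases i <;>
    simp [θs_fst hθs, st_zero_fst hst, st_one_fst hst, st_two_fst hst, st_three_fst hst,
      -ZMod.val_eq_zero] at he he' ⊢ <;> omega

variable [NeZero N]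

include hst hθs hθ hPos hM hP in
/-- The `P`-coordinates of the swapped configuration depend only on the coordinates off `P`
(hypothesis `hΘdep` of the engine, `C = ∅`). [folklore] -/
theorem dependsOn_comp_θ_apply (hN : 2 ≤ N) {G : Type*} (e : (ZMod (2 * N) × ZMod N × ZMod N × ZMod N) × Fin 4)
    (he : e ∈ (P ∪ ∅ : Finset _)) :
    DependsOn (fun U : (ZMod (2 * N) × ZMod N × ZMod N × ZMod N) × Fin 4 → G => (U ∘ θ) e)
      ((Pᶜ : Finset _) : Set ((ZMod (2 * N) × ZMod N × ZMod N × ZMod N) × Fin 4)) := by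
  intro U V hUV
  rw [Finset.union_empty, hP] at he
  have hmem : θ e ∈ ((Pᶜ : Finset _) : Set ((ZMod (2 * N) × ZMod N × ZMod N × ZMod N) × Fin 4)) := by
    rw [Finset.coe_compl, Set.mem_compl_iff, Finset.mem_coe, hP, not_and_or, not_not]
    by_contra h
    rw [not_or, not_not] at h
    exact he.2 (mem_M_of_mem_Pos_of_θ_mem hst hθs hθ hPos hM hN he.1 h.1)
  exact hUV _ hmem

include hθs hθ hM in
omit [NeZero N] in
/-- The swap fixes the shared coordinates (hypothesis `hΘM` of the engine). [folklore] -/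
theorem comp_θ_apply_of_mem_M {G : Type*} (U : (ZMod (2 * N) × ZMod N × ZMod N × ZMod N) × Fin 4 → G)
    (e : (ZMod (2 * N) × ZMod N × ZMod N × ZMod N) × Fin 4) (he : e ∈ M) : (U ∘ θ) e = U e := by
  rw [Function.comp_apply, θ_of_mem_M hθs hθ hM he]

end Links

/-! ### Plaquettes: positive, negative, shared and cut -/

section Plaquettes

variable [NeZero (2 * N)]

include hlt hcut hsh hpos in
omit [NeZero (2 * N)] in
/-- `cut ∪ sh ∪ pos ⊆ lt`. [folklore] -/
theorem union_subset_lt : cut ∪ sh ∪ pos ⊆ lt := by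
  intro k hk
  rw [hlt]
  rcases Finset.mem_union.1 hk with hk | hk
  · rcases Finset.mem_union.1 hk with hk | hk
    · obtain ⟨h1, h2, -⟩ := (hcut k).1 hk; rw [h1, h2]; decide
    · obtain ⟨h1, h2, -⟩ := (hsh k).1 hk; rw [h1, h2]; decide
  · rcases (hpos k).1 hk with ⟨h1, h2, -⟩ | ⟨h1, h2, -⟩ | ⟨h1, h2, -⟩ | ⟨h1, h2, -⟩ <;>
      (try rcases h2 with h2 | h2) <;> rw [h1, h2] <;> decide

include hcut hsh in
omit [NeZero (2 * N)] in
/-- `cut` and `sh` are disjoint. [folklore] -/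
theorem disjoint_cut_sh : Disjoint cut sh := by
  rw [Finset.disjoint_left]; intro k h1 h2
  have h := ((hcut k).1 h1).1; have h' := ((hsh k).1 h2).1
  rw [h] at h'; exact absurd h' (by decide)

include hcut hsh hpos in
omit [NeZero (2 * N)] in
/-- `cut ∪ sh` and `pos` are disjoint. [folklore] -/
theorem disjoint_union_pos : Disjoint (cut ∪ sh) pos := by
  rw [Finset.disjoint_left]; intro k h1 h2
  rw [hpos] at h2
  rcases Finset.mem_union.1 h1 with h1 | h1
  · obtain ⟨hi, hj, hu⟩ := (hcut k).1 h1
    rw [hi, hj] at h2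
    simp at h2; omega
  · obtain ⟨hi, hj, hu⟩ := (hsh k).1 h1
    rw [hi, hj] at h2
    simp at h2; omega

include hθs hd hτ hlt hcut hsh hpos hneg in
/-- **The swap exchanges negative and positive plaquettes**: `k ∈ neg ↔ τ k ∈ pos` (`N ≥ 2`). [folklore] -/
theorem mem_neg_iff_τ_mem_pos (hN : 2 ≤ N) (k : (ZMod (2 * N) × ZMod N × ZMod N × ZMod N) × Fin 4 × Fin 4) :
    k ∈ neg ↔ τ k ∈ pos := by
  obtain ⟨x, i, j⟩ := k
  have h3 := val_neg x.1
  have hl := ZMod.val_lt x.1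
  have hl' := ZMod.val_lt (-x.1)
  rw [hneg, Finset.mem_sdiff, Finset.mem_union, Finset.mem_union, hlt, hcut, hsh, hpos, hpos]
  subst hτ hd
  simp only [θs_fst hθs]
  fin_cases i <;> fin_cases j <;> simp [-ZMod.val_eq_zero] <;> omega

include hst hPos hpos in
/-- The four links of a positive plaquette lie in the closed positive half. [folklore] -/
theorem edges_of_mem_pos {k : (ZMod (2 * N) × ZMod N × ZMod N × ZMod N) × Fin 4 × Fin 4}
    (hk : k ∈ pos) :
    (k.1, k.2.1) ∈ Pos ∧ (k.1 + st k.2.1, k.2.2) ∈ Pos ∧ (k.1 + st k.2.2, k.2.1) ∈ Pos ∧ (k.1, k.2.2) ∈ Pos := by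
  obtain ⟨x, i, j⟩ := k
  have h1 := val_add_one x.1
  have h2 := val_sub_one x.1
  have hl := ZMod.val_lt x.1
  simp only [hPos]
  rw [hpos] at hk
  fin_cases i <;> fin_cases j <;>
    simp [st_zero_fst hst, st_one_fst hst, st_two_fst hst, st_three_fst hst, -ZMod.val_eq_zero] at hk ⊢ <;>
    omega

include hst hM hsh in
omit [NeZero (2 * N)] in
/-- The four links of a shared plaquette are shared. [folklore] -/
theorem edges_of_mem_sh {k : (ZMod (2 * N) × ZMod N × ZMod N × ZMod N) × Fin 4 × Fin 4} (hk : k ∈ sh) :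
    (k.1, k.2.1) ∈ M ∧ (k.1 + st k.2.1, k.2.2) ∈ M ∧ (k.1 + st k.2.2, k.2.1) ∈ M ∧ (k.1, k.2.2) ∈ M := by
  obtain ⟨x, i, j⟩ := k
  obtain ⟨hi, hj, hu⟩ := (hsh _).1 hk
  simp only at hi hj hu; subst hi hj
  simp only [hM]
  simpa [st_two_fst hst, st_three_fst hst] using hu

end Plaquettes

/-! ### Wilson's action split into cut, shared, positive and negative parts -/

section Action

variable {G : Type*} [Group G] {Nc : ℕ} (ρ : G →* Matrix (Fin Nc) (Fin Nc) ℂ)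
  {plaq : ((ZMod (2 * N) × ZMod N × ZMod N × ZMod N) × Fin 4 → G) →
    ZMod (2 * N) × ZMod N × ZMod N × ZMod N → Fin 4 → Fin 4 → G}
  (hplaq : plaq = fun U x i j => U (x, i) * U (x + st i, j) * (U (x + st j, i))⁻¹ * (U (x, j))⁻¹)

include hst hθs hθ hd hτ hplaq in
/-- **`θ`-covariance of the plaquette function**: `Re tr ρ((U ∘ θ)_p) = Re tr ρ(U_{τ p})` for `i < j`.
[folklore] -/
theorem re_trace_plaq_comp_θ (hu : ∀ g, ρ g ∈ Matrix.unitaryGroup (Fin Nc) ℂ)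
    (U : (ZMod (2 * N) × ZMod N × ZMod N × ZMod N) × Fin 4 → G)
    (k : (ZMod (2 * N) × ZMod N × ZMod N × ZMod N) × Fin 4 × Fin 4) (hk : k.2.1 < k.2.2) :
    (ρ (plaq (U ∘ θ) k.1 k.2.1 k.2.2)).trace.re = (ρ (plaq U (τ k).1 (τ k).2.1 (τ k).2.2)).trace.re := by
  obtain ⟨x, i, j⟩ := k
  simp only at hk
  subst hτ
  simp only [plaq_comp_θ hst hθs hθ hplaq]
  by_cases h01 : i = 0 ∧ j = 1
  · obtain ⟨rfl, rfl⟩ := h01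
    have hd' : d ((0 : Fin 4), (1 : Fin 4)) = (0, 1) := by subst hd; decide
    simp only [hd', Equiv.swap_apply_left, Equiv.swap_apply_right]
    rw [plaq_swap_dirs hplaq U (θs x) 0 1, re_trace_map_inv ρ hu]
  · have h10 : ¬ (i = 1 ∧ j = 0) := by rintro ⟨rfl, rfl⟩; exact absurd hk (by decide)
    have hd' : d (i, j) = (Equiv.swap (0 : Fin 4) 1 i, Equiv.swap (0 : Fin 4) 1 j) := by
      subst hd; simp only [h01, h10, or_self, ↓reduceIte]
    simp only [hd']

variable [NeZero N] [NeZero (2 * N)]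

include hθs hd hτ hlt hcut hsh hpos hneg hst hθ hplaq in
omit [NeZero N] in
/-- The negative part of the action is the positive part of the swapped configuration. [folklore] -/
theorem sum_neg_eq_sum_pos_comp_θ (hN : 2 ≤ N) (hu : ∀ g, ρ g ∈ Matrix.unitaryGroup (Fin Nc) ℂ)
    (U : (ZMod (2 * N) × ZMod N × ZMod N × ZMod N) × Fin 4 → G) :
    ∑ k ∈ neg, (ρ (plaq U k.1 k.2.1 k.2.2)).trace.re =
      ∑ k ∈ pos, (ρ (plaq (U ∘ θ) k.1 k.2.1 k.2.2)).trace.re := by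
  refine Finset.sum_equiv (Function.Involutive.toPerm τ (τ_τ hθs hd hτ))
    (fun k => mem_neg_iff_τ_mem_pos hθs hd hτ hlt hcut hsh hpos hneg hN k) (fun k hk => ?_)
  have hk' : τ k ∈ pos := (mem_neg_iff_τ_mem_pos hθs hd hτ hlt hcut hsh hpos hneg hN k).1 hk
  have hklt : (τ k).2.1 < (τ k).2.2 :=
    (hlt _).1 (union_subset_lt hlt hcut hsh hpos (Finset.mem_union_right _ hk'))
  show _ = (ρ (plaq (U ∘ θ) (τ k).1 (τ k).2.1 (τ k).2.2)).trace.re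
  rw [re_trace_plaq_comp_θ hst hθs hθ hd hτ ρ hplaq hu U (τ k) hklt, τ_τ hθs hd hτ]

include hst hθs hθ hd hτ hlt hcut hsh hpos hneg hplaq in
/-- **The split of the action**: `∑ₓ ∑_{i<j} Re tr ρ(U_{x,ij}) = X(U) + S_M(U) + S_P(U) + S_P(U ∘ θ)` (cut,
shared, positive parts). [folklore] -/
theorem act_split {act : ((ZMod (2 * N) × ZMod N × ZMod N × ZMod N) × Fin 4 → G) → ℝ}
    (hact : act = fun U => ∑ x, ∑ i, ∑ j, if i < j then (ρ (plaq U x i j)).trace.re else 0)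
    (hN : 2 ≤ N) (hu : ∀ g, ρ g ∈ Matrix.unitaryGroup (Fin Nc) ℂ)
    (U : (ZMod (2 * N) × ZMod N × ZMod N × ZMod N) × Fin 4 → G) :
    act U = ∑ k ∈ cut, (ρ (plaq U k.1 k.2.1 k.2.2)).trace.re + ∑ k ∈ sh, (ρ (plaq U k.1 k.2.1 k.2.2)).trace.re +
      ∑ k ∈ pos, (ρ (plaq U k.1 k.2.1 k.2.2)).trace.re + ∑ k ∈ pos, (ρ (plaq (U ∘ θ) k.1 k.2.1 k.2.2)).trace.re := by
  have hlt' : lt = Finset.univ.filter fun k => k.2.1 < k.2.2 := by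
    ext k; rw [hlt, Finset.mem_filter]; simp
  have h0 : act U = ∑ k ∈ lt, (ρ (plaq U k.1 k.2.1 k.2.2)).trace.re := by
    rw [hact, hlt', Finset.sum_filter, Fintype.sum_prod_type]
    refine Finset.sum_congr rfl fun x _ => ?_
    rw [Fintype.sum_prod_type]
  rw [h0, ← Finset.sum_sdiff (union_subset_lt hlt hcut hsh hpos), Finset.sum_union (disjoint_union_pos hcut hsh hpos),
    Finset.sum_union (disjoint_cut_sh hcut hsh), ← hneg,
    sum_neg_eq_sum_pos_comp_θ hst hθs hθ hd hτ hlt hcut hsh hpos hneg ρ hplaq hN hu U]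
  ring

include hst hPos hpos hplaq in
omit [NeZero N] in
/-- The positive part of the action depends only on the links of the closed positive half. [folklore] -/
theorem dependsOn_sum_pos :
    DependsOn (fun U : (ZMod (2 * N) × ZMod N × ZMod N × ZMod N) × Fin 4 → G =>
      ∑ k ∈ pos, (ρ (plaq U k.1 k.2.1 k.2.2)).trace.re) Pos := by
  intro U V hUV
  refine Finset.sum_congr rfl fun k hk => ?_
  obtain ⟨h1, h2, h3, h4⟩ := edges_of_mem_pos hst hPos hpos hk
  subst hplaq
  simp only [hUV _ h1, hUV _ h2, hUV _ h3, hUV _ h4]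

include hst hM hsh hplaq in
omit [NeZero N] [NeZero (2 * N)] in
/-- The shared part of the action depends only on the shared links. [folklore] -/
theorem dependsOn_sum_sh :
    DependsOn (fun U : (ZMod (2 * N) × ZMod N × ZMod N × ZMod N) × Fin 4 → G =>
      ∑ k ∈ sh, (ρ (plaq U k.1 k.2.1 k.2.2)).trace.re) (M : Set _) := by
  intro U V hUV
  refine Finset.sum_congr rfl fun k hk => ?_
  obtain ⟨h1, h2, h3, h4⟩ := edges_of_mem_sh hst hM hsh hk
  subst hplaq
  simp only [hUV _ h1, hUV _ h2, hUV _ h3, hUV _ h4]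

include hst hθs hθ hM hsh hplaq in
omit [NeZero N] in
/-- The shared part of the action is swap invariant. [folklore] -/
theorem sum_sh_comp_θ (U : (ZMod (2 * N) × ZMod N × ZMod N × ZMod N) × Fin 4 → G) :
    ∑ k ∈ sh, (ρ (plaq (U ∘ θ) k.1 k.2.1 k.2.2)).trace.re = ∑ k ∈ sh, (ρ (plaq U k.1 k.2.1 k.2.2)).trace.re :=
  dependsOn_sum_sh hst hM hsh ρ hplaq fun e he => comp_θ_apply_of_mem_M hθs hθ hM U e he

omit [NeZero N] [NeZero (2 * N)] in
/-- A sum of plaquette functions over a finset is bounded by `Nc · #labels`. [folklore] -/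
theorem abs_sum_re_trace_le [NeZero N] [NeZero (2 * N)] (hu : ∀ g, ρ g ∈ Matrix.unitaryGroup (Fin Nc) ℂ)
    (s : Finset ((ZMod (2 * N) × ZMod N × ZMod N × ZMod N) × Fin 4 × Fin 4))
    (U : (ZMod (2 * N) × ZMod N × ZMod N × ZMod N) × Fin 4 → G) :
    |∑ k ∈ s, (ρ (plaq U k.1 k.2.1 k.2.2)).trace.re| ≤
      Nc * Fintype.card ((ZMod (2 * N) × ZMod N × ZMod N × ZMod N) × Fin 4 × Fin 4) := by
  calc |∑ k ∈ s, (ρ (plaq U k.1 k.2.1 k.2.2)).trace.re| ≤ ∑ k ∈ s, |(ρ (plaq U k.1 k.2.1 k.2.2)).trace.re| :=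
        Finset.abs_sum_le_sum_abs _ _
    _ ≤ ∑ _k ∈ s, (Nc : ℝ) := Finset.sum_le_sum fun k _ => abs_re_trace_le ρ hu _
    _ ≤ ∑ _k : (ZMod (2 * N) × ZMod N × ZMod N × ZMod N) × Fin 4 × Fin 4, (Nc : ℝ) :=
        Finset.sum_le_sum_of_subset_of_nonneg (Finset.subset_univ _) fun _ _ _ => Nat.cast_nonneg _
    _ = Nc * Fintype.card ((ZMod (2 * N) × ZMod N × ZMod N × ZMod N) × Fin 4 × Fin 4) := by
        rw [Finset.sum_const, Finset.card_univ, nsmul_eq_mul, mul_comm]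

variable [TopologicalSpace G] [IsTopologicalGroup G] [MeasurableSpace G] [BorelSpace G]

include hplaq in
omit [NeZero N] [NeZero (2 * N)] in
/-- The plaquette function `U ↦ Re tr ρ(U_p)` is measurable (continuous `ρ`). [folklore] -/
theorem measurable_re_trace_plaq (hρ : Continuous ρ) (x : ZMod (2 * N) × ZMod N × ZMod N × ZMod N) (i j : Fin 4) :
    Measurable fun U : (ZMod (2 * N) × ZMod N × ZMod N × ZMod N) × Fin 4 → G => (ρ (plaq U x i j)).trace.re := by
  subst hplaq
  exact measurable_re_trace ρ (entryMeasurable_mul ρ (entryMeasurable_mul ρ (entryMeasurable_mul ρ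
    (entryMeasurable_apply ρ hρ _) (entryMeasurable_apply ρ hρ _)) (entryMeasurable_apply_inv ρ hρ _))
    (entryMeasurable_apply_inv ρ hρ _))

include hplaq in
omit [NeZero N] [NeZero (2 * N)] in
/-- A sum of plaquette functions is measurable. [folklore] -/
theorem measurable_sum_re_trace_plaq (hρ : Continuous ρ)
    (s : Finset ((ZMod (2 * N) × ZMod N × ZMod N × ZMod N) × Fin 4 × Fin 4)) :
    Measurable fun U : (ZMod (2 * N) × ZMod N × ZMod N × ZMod N) × Fin 4 → G =>
      ∑ k ∈ s, (ρ (plaq U k.1 k.2.1 k.2.2)).trace.re :=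
  Finset.measurable_sum _ fun _ _ => measurable_re_trace_plaq ρ hplaq hρ _ _ _

end Action


/-! ### The cut: the crossing `(0,1)`-plaquettes as a Gram kernel -/

section Cut

variable [NeZero (2 * N)] {G : Type*} [Group G] {Nc : ℕ} (ρ : G →* Matrix (Fin Nc) (Fin Nc) ℂ)
  {plaq : ((ZMod (2 * N) × ZMod N × ZMod N × ZMod N) × Fin 4 → G) →
    ZMod (2 * N) × ZMod N × ZMod N × ZMod N → Fin 4 → Fin 4 → G}
  (hplaq : plaq = fun U x i j => U (x, i) * U (x + st i, j) * (U (x + st j, i))⁻¹ * (U (x, j))⁻¹)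
  {cl : (ZMod (2 * N) × ZMod N × ZMod N × ZMod N) × Fin 4 × Fin 4 →
    ((ZMod (2 * N) × ZMod N × ZMod N × ZMod N) × Fin 4 → G) → G}
  (hcl : cl = fun k U => if k.1.1 = 0 then U (k.1, 0) * U (k.1 + st 0, 1) else U (k.1, 1) * U (k.1 + st 1, 0))

include hst hθs hθ hcut hplaq hcl in
/-- **The cut identity**: for a cut plaquette `U_p = P₊ (P₊ ∘ Θ)⁻¹` (layer `0`) or `(P₊ ∘ Θ) P₊⁻¹` (layer `N`),
where `P₊ = cl p` is the product of its two links in the closed half (`U(x,0) U(x+e₀,1)`, resp.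
`U(x,1) U(x+e₁,0)`); hence `Re tr ρ(U_p) = Re ∑_{ab} ρ(P₊(U))_{ab} conj ρ(P₊(U ∘ θ))_{ab}`. [folklore] -/
theorem re_trace_plaq_eq_of_mem_cut (hu : ∀ g, ρ g ∈ Matrix.unitaryGroup (Fin Nc) ℂ)
    {k : (ZMod (2 * N) × ZMod N × ZMod N × ZMod N) × Fin 4 × Fin 4} (hk : k ∈ cut)
    (U : (ZMod (2 * N) × ZMod N × ZMod N × ZMod N) × Fin 4 → G) :
    (ρ (plaq U k.1 k.2.1 k.2.2)).trace.re = (∑ a, ∑ b, ρ (cl k U) a b * conj (ρ (cl k (U ∘ θ)) a b)).re := by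
  obtain ⟨x, i, j⟩ := k
  obtain ⟨hi, hj, hux⟩ := (hcut _).1 hk
  simp only at hi hj hux
  subst hi hj hcl hθ
  rw [← re_trace_map_mul_inv ρ hu]
  rcases hux with h0 | hN
  · have hx : x.1 = 0 := (ZMod.val_eq_zero _).1 h0
    have hθx : θs x = x := θs_of_fst_eq_zero hθs hx
    subst hplaq
    simp only [hx, ↓reduceIte, Function.comp_apply, θs_add_st hst hθs, hθx, Equiv.swap_apply_left,
      Equiv.swap_apply_right]
    congr 2
    group
  · have hx : x.1 = (N : ZMod (2 * N)) := (val_eq_N_iff _).1 hN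
    have hx0 : x.1 ≠ 0 := by
      intro h; rw [h, ZMod.val_zero] at hN
      exact NeZero.ne (2 * N) (by omega)
    have hθx : θs x = x := θs_of_fst_eq_N hθs hx
    rw [re_trace_map_mul_inv_comm ρ hu]
    subst hplaq
    simp only [hx0, ↓reduceIte, Function.comp_apply, θs_add_st hst hθs, hθx, Equiv.swap_apply_left,
      Equiv.swap_apply_right]
    congr 2
    group

include hst hPos hcut hcl in
/-- The two links of `P₊` lie in the closed positive half. [folklore] -/
theorem cl_congr {k : (ZMod (2 * N) × ZMod N × ZMod N × ZMod N) × Fin 4 × Fin 4} (hk : k ∈ cut)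
    {U V : (ZMod (2 * N) × ZMod N × ZMod N × ZMod N) × Fin 4 → G} (hUV : ∀ e ∈ Pos, U e = V e) :
    cl k U = cl k V := by
  obtain ⟨x, i, j⟩ := k
  obtain ⟨-, -, hux⟩ := (hcut _).1 hk
  simp only at hux
  have h1 := val_add_one x.1
  have h2 := val_sub_one x.1
  have hl := ZMod.val_lt x.1
  have hN1 : 1 ≤ N := by have := NeZero.ne (2 * N); omega
  subst hcl
  by_cases hx : x.1 = 0
  · have h0 : x.1.val = 0 := by rw [hx, ZMod.val_zero]
    simp only [hx, ↓reduceIte]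
    rw [hUV _ (by rw [hPos]; simp [st_zero_fst hst, -ZMod.val_eq_zero]; omega),
      hUV _ (by rw [hPos]; simp [st_zero_fst hst, st_one_fst hst, -ZMod.val_eq_zero]; omega)]
  · have h0 : x.1.val ≠ 0 := fun h => hx ((ZMod.val_eq_zero _).1 h)
    simp only [hx, ↓reduceIte]
    rw [hUV _ (by rw [hPos]; simp [st_one_fst hst, -ZMod.val_eq_zero]; omega),
      hUV _ (by rw [hPos]; simp [st_zero_fst hst, st_one_fst hst, -ZMod.val_eq_zero]; omega)]

variable {β : ℝ}
  {a : ((ZMod (2 * N) × ZMod N × ZMod N × ZMod N) × Fin 4 × Fin 4) × Fin Nc × Fin Nc × Bool →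
    ((ZMod (2 * N) × ZMod N × ZMod N × ZMod N) × Fin 4 → G) → ℂ}
  (ha : a = fun i U => if i.1 ∈ cut then (Real.sqrt (β / 2) : ℂ) *
    (if i.2.2.2 then conj (ρ (cl i.1 U) i.2.1 i.2.2.1) else ρ (cl i.1 U) i.2.1 i.2.2.1) else 0)

include hst hθs hθ hcut hplaq hcl ha in
/-- **The cut Boltzmann weight is a Gram kernel**: with the coefficients `aᵢ ∈ {√(β/2) ρ(P₊)_{ab},
√(β/2) conj ρ(P₊)_{ab}}` (cut plaquettes; `0` else), `∑ᵢ aᵢ(U) conj aᵢ(U ∘ θ) = β X(U)`. [folklore] -/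
theorem sum_a_mul_conj [NeZero N] (hu : ∀ g, ρ g ∈ Matrix.unitaryGroup (Fin Nc) ℂ) (hβ : 0 ≤ β)
    (U : (ZMod (2 * N) × ZMod N × ZMod N × ZMod N) × Fin 4 → G) :
    ∑ i, a i U * conj (a i (U ∘ θ)) = ((β * ∑ k ∈ cut, (ρ (plaq U k.1 k.2.1 k.2.2)).trace.re : ℝ) : ℂ) := by
  have hs : (Real.sqrt (β / 2) : ℂ) * (Real.sqrt (β / 2) : ℂ) = ((β / 2 : ℝ) : ℂ) := by
    rw [← Complex.ofReal_mul, Real.mul_self_sqrt (by linarith)]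
  have hpt : ∀ k : (ZMod (2 * N) × ZMod N × ZMod N × ZMod N) × Fin 4 × Fin 4,
      ∑ r : Fin Nc × Fin Nc × Bool, a (k, r) U * conj (a (k, r) (U ∘ θ)) =
        if k ∈ cut then ((β * (ρ (plaq U k.1 k.2.1 k.2.2)).trace.re : ℝ) : ℂ) else 0 := by
    intro k
    by_cases hk : k ∈ cut
    · rw [if_pos hk, re_trace_plaq_eq_of_mem_cut hst hθs hθ hcut ρ hplaq hcl hu hk U, Complex.re_sum,
        Finset.mul_sum, Complex.ofReal_sum, Fintype.sum_prod_type]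
      refine Finset.sum_congr rfl fun x _ => ?_
      rw [Complex.re_sum, Finset.mul_sum, Complex.ofReal_sum, Fintype.sum_prod_type]
      refine Finset.sum_congr rfl fun y _ => ?_
      rw [Fintype.sum_bool]
      subst ha
      simp only [if_pos hk, ↓reduceIte, Bool.false_eq_true, map_mul, Complex.conj_ofReal, Complex.conj_conj]
      set u := ρ (cl k U) x y
      set v := ρ (cl k (U ∘ θ)) x y
      calc (Real.sqrt (β / 2) : ℂ) * conj u * ((Real.sqrt (β / 2) : ℂ) * v) +
            (Real.sqrt (β / 2) : ℂ) * u * ((Real.sqrt (β / 2) : ℂ) * conj v)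
          = ((Real.sqrt (β / 2) : ℂ) * (Real.sqrt (β / 2) : ℂ)) * (u * conj v + conj (u * conj v)) := by
            simp only [map_mul, Complex.conj_conj]; ring
        _ = ((β * (u * conj v).re : ℝ) : ℂ) := by
            rw [hs, Complex.add_conj]; push_cast; ring
    · rw [if_neg hk]
      refine Finset.sum_eq_zero fun r _ => ?_
      subst ha
      simp only [if_neg hk, zero_mul]
  rw [Fintype.sum_prod_type]
  simp_rw [hpt]
  rw [Finset.sum_ite_mem, Finset.univ_inter, Finset.mul_sum, Complex.ofReal_sum]

include ha in
omit [NeZero (2 * N)] in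
/-- The Gram coefficients are bounded by `√(β/2)`. [folklore] -/
theorem norm_a_le (hu : ∀ g, ρ g ∈ Matrix.unitaryGroup (Fin Nc) ℂ)
    (i : ((ZMod (2 * N) × ZMod N × ZMod N × ZMod N) × Fin 4 × Fin 4) × Fin Nc × Fin Nc × Bool)
    (U : (ZMod (2 * N) × ZMod N × ZMod N × ZMod N) × Fin 4 → G) : ‖a i U‖ ≤ Real.sqrt (β / 2) := by
  subst ha
  dsimp only
  split_ifs with hk hb
  · rw [norm_mul, Complex.norm_real, Real.norm_eq_abs, abs_of_nonneg (Real.sqrt_nonneg _), Complex.norm_conj]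
    exact mul_le_of_le_one_right (Real.sqrt_nonneg _) (norm_entry_le_one ρ hu _ _ _)
  · rw [norm_mul, Complex.norm_real, Real.norm_eq_abs, abs_of_nonneg (Real.sqrt_nonneg _)]
    exact mul_le_of_le_one_right (Real.sqrt_nonneg _) (norm_entry_le_one ρ hu _ _ _)
  · rw [norm_zero]; exact Real.sqrt_nonneg _

include hst hPos hcut hcl ha in
/-- The Gram coefficients depend only on the links of the closed positive half. [folklore] -/
theorem dependsOn_a (i : ((ZMod (2 * N) × ZMod N × ZMod N × ZMod N) × Fin 4 × Fin 4) × Fin Nc × Fin Nc × Bool) :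
    DependsOn (a i) Pos := by
  intro U V hUV
  subst ha
  by_cases hk : i.1 ∈ cut
  · simp only [if_pos hk, cl_congr hst hPos hcut hcl hk hUV]
  · simp only [if_neg hk]

variable [TopologicalSpace G] [MeasurableSpace G] [BorelSpace G]

include hcl ha in
omit [NeZero (2 * N)] in
/-- The Gram coefficients are measurable (continuous `ρ`). [folklore] -/
theorem measurable_a (hρ : Continuous ρ)
    (i : ((ZMod (2 * N) × ZMod N × ZMod N × ZMod N) × Fin 4 × Fin 4) × Fin Nc × Fin Nc × Bool) :
    Measurable (a i) := by
  have hclm : ∀ x y, Measurable fun U : (ZMod (2 * N) × ZMod N × ZMod N × ZMod N) × Fin 4 → G =>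
      ρ (cl i.1 U) x y := by
    subst hcl
    by_cases h : i.1.1.1 = 0
    · simp only [h, ↓reduceIte]
      exact entryMeasurable_mul ρ (entryMeasurable_apply ρ hρ _) (entryMeasurable_apply ρ hρ _)
    · simp only [h, ↓reduceIte]
      exact entryMeasurable_mul ρ (entryMeasurable_apply ρ hρ _) (entryMeasurable_apply ρ hρ _)
  subst ha
  by_cases hk : i.1 ∈ cut
  · simp only [if_pos hk]
    by_cases hb : i.2.2.2 = true
    · simp only [hb, ↓reduceIte]
      exact (Complex.continuous_conj.measurable.comp (hclm _ _)).const_mul _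
    · simp only [hb, Bool.false_eq_true, ↓reduceIte]
      exact (hclm _ _).const_mul _
  · simp only [if_neg hk]
    exact measurable_const

end Cut

/-! ### The observable `g = F · e^{β S_P} · e^{β S_M / 2}` and measure preservation -/

section Observable

variable [NeZero N] [NeZero (2 * N)] {G : Type*} [Group G] {Nc : ℕ} (ρ : G →* Matrix (Fin Nc) (Fin Nc) ℂ)
  {plaq : ((ZMod (2 * N) × ZMod N × ZMod N × ZMod N) × Fin 4 → G) →
    ZMod (2 * N) × ZMod N × ZMod N × ZMod N → Fin 4 → Fin 4 → G}
  (hplaq : plaq = fun U x i j => U (x, i) * U (x + st i, j) * (U (x + st j, i))⁻¹ * (U (x, j))⁻¹)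
  {β : ℝ} {F g : ((ZMod (2 * N) × ZMod N × ZMod N × ZMod N) × Fin 4 → G) → ℂ}
  (hg : g = fun U => F U * (Real.exp (β * ∑ k ∈ pos, (ρ (plaq U k.1 k.2.1 k.2.2)).trace.re +
    β / 2 * ∑ k ∈ sh, (ρ (plaq U k.1 k.2.1 k.2.2)).trace.re) : ℂ))

include hg in
/-- `g` is bounded. [folklore] -/
theorem norm_g_le (hu : ∀ g, ρ g ∈ Matrix.unitaryGroup (Fin Nc) ℂ) {C : ℝ} (hFb : ∀ U, ‖F U‖ ≤ C)
    (U : (ZMod (2 * N) × ZMod N × ZMod N × ZMod N) × Fin 4 → G) :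
    ‖g U‖ ≤ |C| * Real.exp ((|β| + |β / 2|) *
      (Nc * Fintype.card ((ZMod (2 * N) × ZMod N × ZMod N × ZMod N) × Fin 4 × Fin 4))) := by
  subst hg
  rw [norm_mul, Complex.norm_real, Real.norm_eq_abs, abs_of_pos (Real.exp_pos _)]
  refine mul_le_mul ((hFb U).trans (le_abs_self _)) ?_ (Real.exp_pos _).le (abs_nonneg _)
  refine Real.exp_le_exp.2 ?_
  rw [add_mul]
  refine add_le_add ?_ ?_
  · calc β * ∑ k ∈ pos, (ρ (plaq U k.1 k.2.1 k.2.2)).trace.re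
        ≤ |β * ∑ k ∈ pos, (ρ (plaq U k.1 k.2.1 k.2.2)).trace.re| := le_abs_self _
      _ = |β| * |∑ k ∈ pos, (ρ (plaq U k.1 k.2.1 k.2.2)).trace.re| := abs_mul _ _
      _ ≤ |β| * (Nc * Fintype.card ((ZMod (2 * N) × ZMod N × ZMod N × ZMod N) × Fin 4 × Fin 4)) :=
          mul_le_mul_of_nonneg_left (abs_sum_re_trace_le ρ hu _ U) (abs_nonneg _)
  · calc β / 2 * ∑ k ∈ sh, (ρ (plaq U k.1 k.2.1 k.2.2)).trace.re
        ≤ |β / 2 * ∑ k ∈ sh, (ρ (plaq U k.1 k.2.1 k.2.2)).trace.re| := le_abs_self _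
      _ = |β / 2| * |∑ k ∈ sh, (ρ (plaq U k.1 k.2.1 k.2.2)).trace.re| := abs_mul _ _
      _ ≤ |β / 2| * (Nc * Fintype.card ((ZMod (2 * N) × ZMod N × ZMod N × ZMod N) × Fin 4 × Fin 4)) :=
          mul_le_mul_of_nonneg_left (abs_sum_re_trace_le ρ hu _ U) (abs_nonneg _)

include hst hPos hM hsh hpos hplaq hg in
omit [NeZero N] in
/-- `g` depends only on the links of the closed positive half. [folklore] -/
theorem dependsOn_g (hFdep : DependsOn F Pos) : DependsOn g Pos := by
  intro U V hUV
  have hMUV : ∀ e ∈ (M : Set ((ZMod (2 * N) × ZMod N × ZMod N × ZMod N) × Fin 4)), U e = V e :=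
    fun e he => hUV e (mem_Pos_of_mem_M hst hPos hM (Finset.mem_coe.1 he))
  subst hg
  simp only [hFdep hUV, dependsOn_sum_pos hst hPos hpos ρ hplaq hUV, dependsOn_sum_sh hst hM hsh ρ hplaq hMUV]

variable [TopologicalSpace G] [IsTopologicalGroup G] [MeasurableSpace G] [BorelSpace G]

include hplaq hg in
omit [NeZero N] [NeZero (2 * N)] in
/-- `g` is measurable. [folklore] -/
theorem measurable_g (hρ : Continuous ρ) (hF : Measurable F) : Measurable g := by
  subst hg
  exact hF.mul (Complex.measurable_ofReal.comp
    (((measurable_sum_re_trace_plaq ρ hplaq hρ _).const_mul β).add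
      ((measurable_sum_re_trace_plaq ρ hplaq hρ _).const_mul (β / 2))).exp)

variable [CompactSpace G]

include hθs hθ in
omit [IsTopologicalGroup G] in
/-- **`U ↦ U ∘ θ` preserves the product Haar measure** (relabelling of the factors by the involution `θ`).
[folklore] -/
theorem measurePreserving_comp_θ [IsTopologicalGroup G] :
    MeasurePreserving (fun U : (ZMod (2 * N) × ZMod N × ZMod N × ZMod N) × Fin 4 → G => U ∘ θ)
      (piMeasure (haarProbability G)) (piMeasure (haarProbability G)) := by
  have h1 : MeasurePreserving
      (MeasurableEquiv.arrowCongr' (Function.Involutive.toPerm θ (θ_θ hθs hθ)) (MeasurableEquiv.refl G))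
      (piMeasure (haarProbability G)) (piMeasure (haarProbability G)) :=
    measurePreserving_arrowCongr' (fun _ => haarProbability G) (fun _ => haarProbability G)
      (Function.Involutive.toPerm θ (θ_θ hθs hθ)) (MeasurableEquiv.refl G) fun _ => MeasurePreserving.id _
  have heq : (fun U : (ZMod (2 * N) × ZMod N × ZMod N × ZMod N) × Fin 4 → G => U ∘ θ) =
      ⇑(MeasurableEquiv.arrowCongr' (Function.Involutive.toPerm θ (θ_θ hθs hθ)) (MeasurableEquiv.refl G)) := by
    funext U e
    rfl
  rw [heq]
  exact h1

end Observable

/-! ### Assembly -/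

section Assembly

variable [NeZero N] [NeZero (2 * N)] {G : Type*} [Group G] [TopologicalSpace G] [IsTopologicalGroup G]
  [CompactSpace G] [MeasurableSpace G] [BorelSpace G] {Nc : ℕ} (ρ : G →* Matrix (Fin Nc) (Fin Nc) ℂ)
  {plaq : ((ZMod (2 * N) × ZMod N × ZMod N × ZMod N) × Fin 4 → G) →
    ZMod (2 * N) × ZMod N × ZMod N × ZMod N → Fin 4 → Fin 4 → G}
  (hplaq : plaq = fun U x i j => U (x, i) * U (x + st i, j) * (U (x + st j, i))⁻¹ * (U (x, j))⁻¹)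
  {act : ((ZMod (2 * N) × ZMod N × ZMod N × ZMod N) × Fin 4 → G) → ℝ}
  (hact : act = fun U => ∑ x, ∑ i, ∑ j, if i < j then (ρ (plaq U x i j)).trace.re else 0)
  {cl : (ZMod (2 * N) × ZMod N × ZMod N × ZMod N) × Fin 4 × Fin 4 →
    ((ZMod (2 * N) × ZMod N × ZMod N × ZMod N) × Fin 4 → G) → G}
  (hcl : cl = fun k U => if k.1.1 = 0 then U (k.1, 0) * U (k.1 + st 0, 1) else U (k.1, 1) * U (k.1 + st 1, 0))
  {β : ℝ}
  {a : ((ZMod (2 * N) × ZMod N × ZMod N × ZMod N) × Fin 4 × Fin 4) × Fin Nc × Fin Nc × Bool →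
    ((ZMod (2 * N) × ZMod N × ZMod N × ZMod N) × Fin 4 → G) → ℂ}
  (ha : a = fun i U => if i.1 ∈ cut then (Real.sqrt (β / 2) : ℂ) *
    (if i.2.2.2 then conj (ρ (cl i.1 U) i.2.1 i.2.2.1) else ρ (cl i.1 U) i.2.1 i.2.2.1) else 0)
  {F g : ((ZMod (2 * N) × ZMod N × ZMod N × ZMod N) × Fin 4 → G) → ℂ}
  (hg : g = fun U => F U * (Real.exp (β * ∑ k ∈ pos, (ρ (plaq U k.1 k.2.1 k.2.2)).trace.re +
    β / 2 * ∑ k ∈ sh, (ρ (plaq U k.1 k.2.1 k.2.2)).trace.re) : ℂ))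

include hst hθs hθ hd hτ hM hlt hcut hsh hpos hneg hplaq hact hcl ha hg in
omit [TopologicalSpace G] [IsTopologicalGroup G] [CompactSpace G] [MeasurableSpace G] [BorelSpace G] in
/-- **The pointwise identity**:
`conj F(U ∘ θ) F(U) e^{β ∑ Re tr ρ(U_p)} = g(U) conj g(U ∘ θ) exp(∑ᵢ aᵢ(U) conj aᵢ(U ∘ θ))`. [folklore] -/
theorem integrand_eq (hN : 2 ≤ N) (hu : ∀ g, ρ g ∈ Matrix.unitaryGroup (Fin Nc) ℂ) (hβ : 0 ≤ β)
    (U : (ZMod (2 * N) × ZMod N × ZMod N × ZMod N) × Fin 4 → G) :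
    conj (F (U ∘ θ)) * F U * ((Real.exp (β * act U) : ℝ) : ℂ) =
      g U * conj (g (U ∘ θ)) * Complex.exp (∑ i, a i U * conj (a i (U ∘ θ))) := by
  rw [sum_a_mul_conj hst hθs hθ hcut ρ hplaq hcl ha hu hβ, ← Complex.ofReal_exp,
    act_split hst hθs hθ hd hτ hlt hcut hsh hpos hneg ρ hplaq hact hN hu U]
  subst hg
  dsimp only
  rw [sum_sh_comp_θ hst hθs hθ hM hsh ρ hplaq U]
  simp only [map_mul, Complex.conj_ofReal]
  set XC := ∑ k ∈ cut, (ρ (plaq U k.1 k.2.1 k.2.2)).trace.re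
  set XM := ∑ k ∈ sh, (ρ (plaq U k.1 k.2.1 k.2.2)).trace.re
  set XP := ∑ k ∈ pos, (ρ (plaq U k.1 k.2.1 k.2.2)).trace.re
  set XP' := ∑ k ∈ pos, (ρ (plaq (U ∘ θ) k.1 k.2.1 k.2.2)).trace.re
  rw [show β * (XC + XM + XP + XP') = (β * XP + β / 2 * XM) + (β * XP' + β / 2 * XM) + β * XC by ring,
    Real.exp_add, Real.exp_add]
  push_cast
  ring

include hst hθs hθ hd hτ hPos hM hP hlt hcut hsh hpos hneg hplaq hact hcl ha hg in
/-- **Swap reflection positivity of the un-normalised Wilson weight** (all bookkeeping objects as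
parameters): `0 ≤ ∫ conj F(U ∘ θ) F(U) exp(β ∑ Re tr ρ(U_p)) ∏ dU_e` as a complex number. [folklore] -/
theorem integral_conj_comp_θ_mul_nonneg_aux (hN : 2 ≤ N) (hρ : Continuous ρ)
    (hu : ∀ g, ρ g ∈ Matrix.unitaryGroup (Fin Nc) ℂ) (hβ : 0 ≤ β) (hF : Measurable F) {C : ℝ}
    (hFb : ∀ U, ‖F U‖ ≤ C) (hFdep : DependsOn F Pos) :
    0 ≤ ∫ U, conj (F (U ∘ θ)) * F U * ((Real.exp (β * act U) : ℝ) : ℂ)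
      ∂(piMeasure (haarProbability G) :
        Measure ((ZMod (2 * N) × ZMod N × ZMod N × ZMod N) × Fin 4 → G)) := by
  have key := integral_mul_conj_mul_exp_nonneg_of_shared (haarProbability G) M P
    (∅ : Finset ((ZMod (2 * N) × ZMod N × ZMod N × ZMod N) × Fin 4))
    (fun U : (ZMod (2 * N) × ZMod N × ZMod N × ZMod N) × Fin 4 → G => U ∘ θ)
    (measurePreserving_comp_θ hθs hθ) (fun U e he => comp_θ_apply_of_mem_M hθs hθ hM U e he)
    (fun e he => dependsOn_comp_θ_apply hst hθs hθ hPos hM hP hN e he) (disjoint_M_P hP)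
    (Finset.disjoint_empty_right _) (measurable_g ρ hplaq hg hρ hF) (fun i => measurable_a ρ hcl ha hρ i)
    (norm_g_le ρ hg hu hFb) (fun i U => norm_a_le ρ ha hu i U)
    (dependsOn_union_of_Pos hP (dependsOn_g hst hPos hM hsh hpos ρ hplaq hg hFdep))
    (fun i => dependsOn_union_of_Pos hP (dependsOn_a hst hPos hcut ρ hcl ha i))
  have hsplice : ∀ p : ((ZMod (2 * N) × ZMod N × ZMod N × ZMod N) × Fin 4 → G) ×
      ((ZMod (2 * N) × ZMod N × ZMod N × ZMod N) × Fin 4 → G),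
      splice (∅ : Finset ((ZMod (2 * N) × ZMod N × ZMod N × ZMod N) × Fin 4)) p = p.1 := fun p => by
    funext i
    simp [splice_apply]
  simp_rw [hsplice] at key
  rw [integral_fun_fst (fun U : (ZMod (2 * N) × ZMod N × ZMod N × ZMod N) × Fin 4 → G =>
      g U * conj (g (U ∘ θ)) * Complex.exp (∑ i, a i U * conj (a i (U ∘ θ)))), probReal_univ, one_smul] at key
  simp_rw [← integrand_eq hst hθs hθ hd hτ hM hlt hcut hsh hpos hneg ρ hplaq hact hcl ha hg hN hu hβ] at key
  exact key

end Assembly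

end Param

/-! ### The main theorem -/

section Main

variable {G : Type*} [Group G] [TopologicalSpace G] [IsTopologicalGroup G] [CompactSpace G] [MeasurableSpace G]
  [BorelSpace G] {Nc : ℕ} (ρ : G →* Matrix (Fin Nc) (Fin Nc) ℂ)

/-- **Swap reflection positivity of the Wilson action on the Fröhlich–Israel–Lieb–Simon 45° torus**
(reflection through the diagonal lattice hyperplanes `x₀ = x₁`, `x₀ = x₁ + N`; FILS 1978 Thm. 2.1 in the
tilted geometry of FILS II §3; Osterwalder–Seiler 1978 §2 for the Wilson action). Data, in the chart
`(u,w,y,z) = (x₀−x₁, x₁, x₂, x₃)` of `T̃_N = ℤ_{2N} × ℤ_N × ℤ_N × ℤ_N`: steps `st` (`e₀ = (1,0,0,0)`,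
`e₁ = (−1,1,0,0)`, `e₂`, `e₃`), the site swap `θs (u,w,y,z) = (−u, w + ū, y, z)`, the link swap
`θ (x, i) = (θs x, σ i)` with `σ = (0 1)`, the configuration swap `Θ U = U ∘ θ`, the plaquette holonomy
`plaq U x i j = U(x,i) U(x+eᵢ,j) U(x+eⱼ,i)⁻¹ U(x,j)⁻¹`, Wilson's action `act U = ∑ₓ ∑_{i<j} Re tr ρ(U_{x,ij})`,
the weight `wt = exp(β · act)`, product Haar measure `μ`, and the closed half
`Pos = {(x,i) : u(x) ≤ N, u(x + eᵢ) ≤ N}` — all given as parameters with their defining equations, so that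
named instances are plugged in by `rfl`. Conclusion: for a compact group `G`, a continuous unitary `ρ`,
`β ≥ 0`, `N ≥ 2` and `F` bounded measurable depending only on `Pos`,
`0 ≤ ∫ conj F(Θ U) · F U · wt U dμ(U)` (a real non-negative complex number). [cite: FILS1978, Thm 2.1] -/
theorem integral_conj_swap_mul_nonneg (hρ : Continuous ρ) (hu : ∀ g, ρ g ∈ Matrix.unitaryGroup (Fin Nc) ℂ)
    {N : ℕ} [NeZero N] [NeZero (2 * N)] (hN : 2 ≤ N)
    (st : Fin 4 → ZMod (2 * N) × ZMod N × ZMod N × ZMod N)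
    (hst : st = ![((1 : ZMod (2 * N)), (0 : ZMod N), (0 : ZMod N), (0 : ZMod N)),
      ((-1 : ZMod (2 * N)), (1 : ZMod N), (0 : ZMod N), (0 : ZMod N)),
      ((0 : ZMod (2 * N)), (0 : ZMod N), (1 : ZMod N), (0 : ZMod N)),
      ((0 : ZMod (2 * N)), (0 : ZMod N), (0 : ZMod N), (1 : ZMod N))])
    (θs : ZMod (2 * N) × ZMod N × ZMod N × ZMod N → ZMod (2 * N) × ZMod N × ZMod N × ZMod N)
    (hθs : θs = fun x => (-x.1, x.2.1 + ZMod.castHom (dvd_mul_left N 2) (ZMod N) x.1, x.2.2.1, x.2.2.2))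
    (θ : (ZMod (2 * N) × ZMod N × ZMod N × ZMod N) × Fin 4 → (ZMod (2 * N) × ZMod N × ZMod N × ZMod N) × Fin 4)
    (hθ : θ = fun e => (θs e.1, Equiv.swap (0 : Fin 4) 1 e.2))
    (Θ : ((ZMod (2 * N) × ZMod N × ZMod N × ZMod N) × Fin 4 → G) →
      (ZMod (2 * N) × ZMod N × ZMod N × ZMod N) × Fin 4 → G)
    (hΘ : Θ = fun U => U ∘ θ)
    (plaq : ((ZMod (2 * N) × ZMod N × ZMod N × ZMod N) × Fin 4 → G) →
      ZMod (2 * N) × ZMod N × ZMod N × ZMod N → Fin 4 → Fin 4 → G)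
    (hplaq : plaq = fun U x i j => U (x, i) * U (x + st i, j) * (U (x + st j, i))⁻¹ * (U (x, j))⁻¹)
    (act : ((ZMod (2 * N) × ZMod N × ZMod N × ZMod N) × Fin 4 → G) → ℝ)
    (hact : act = fun U => ∑ x, ∑ i, ∑ j, if i < j then (ρ (plaq U x i j)).trace.re else 0)
    {β : ℝ} (hβ : 0 ≤ β)
    (wt : ((ZMod (2 * N) × ZMod N × ZMod N × ZMod N) × Fin 4 → G) → ℝ) (hwt : wt = fun U => Real.exp (β * act U))
    (μ : Measure ((ZMod (2 * N) × ZMod N × ZMod N × ZMod N) × Fin 4 → G))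
    (hμ : μ = Measure.pi fun _ => haarProbability G)
    (Pos : Set ((ZMod (2 * N) × ZMod N × ZMod N × ZMod N) × Fin 4))
    (hPos : ∀ e, e ∈ Pos ↔ e.1.1.val ≤ N ∧ (e.1 + st e.2).1.val ≤ N)
    {F : ((ZMod (2 * N) × ZMod N × ZMod N × ZMod N) × Fin 4 → G) → ℂ} (hF : Measurable F)
    {C : ℝ} (hFb : ∀ U, ‖F U‖ ≤ C) (hFdep : DependsOn F Pos) :
    0 ≤ ∫ U, conj (F (Θ U)) * F U * ((wt U : ℝ) : ℂ) ∂μ := by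
  subst hΘ hwt hμ
  classical
  -- the bookkeeping objects
  set M : Finset ((ZMod (2 * N) × ZMod N × ZMod N × ZMod N) × Fin 4) :=
    Finset.univ.filter fun e => (e.2 = 2 ∨ e.2 = 3) ∧ (e.1.1.val = 0 ∨ e.1.1.val = N) with hMdef
  have hM : ∀ e, e ∈ M ↔ (e.2 = 2 ∨ e.2 = 3) ∧ (e.1.1.val = 0 ∨ e.1.1.val = N) := fun e => by
    rw [hMdef, Finset.mem_filter]; simp
  set P : Finset ((ZMod (2 * N) × ZMod N × ZMod N × ZMod N) × Fin 4) :=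
    Finset.univ.filter fun e => e ∈ Pos ∧ e ∉ M with hPdef
  have hP : ∀ e, e ∈ P ↔ e ∈ Pos ∧ e ∉ M := fun e => by rw [hPdef, Finset.mem_filter]; simp
  set lt : Finset ((ZMod (2 * N) × ZMod N × ZMod N × ZMod N) × Fin 4 × Fin 4) :=
    Finset.univ.filter fun k => k.2.1 < k.2.2 with hltdef
  have hlt : ∀ k, k ∈ lt ↔ k.2.1 < k.2.2 := fun k => by rw [hltdef, Finset.mem_filter]; simp
  set cut : Finset ((ZMod (2 * N) × ZMod N × ZMod N × ZMod N) × Fin 4 × Fin 4) :=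
    Finset.univ.filter fun k => k.2.1 = 0 ∧ k.2.2 = 1 ∧ (k.1.1.val = 0 ∨ k.1.1.val = N) with hcutdef
  have hcut : ∀ k, k ∈ cut ↔ k.2.1 = 0 ∧ k.2.2 = 1 ∧ (k.1.1.val = 0 ∨ k.1.1.val = N) := fun k => by
    rw [hcutdef, Finset.mem_filter]; simp
  set sh : Finset ((ZMod (2 * N) × ZMod N × ZMod N × ZMod N) × Fin 4 × Fin 4) :=
    Finset.univ.filter fun k => k.2.1 = 2 ∧ k.2.2 = 3 ∧ (k.1.1.val = 0 ∨ k.1.1.val = N) with hshdef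
  have hsh : ∀ k, k ∈ sh ↔ k.2.1 = 2 ∧ k.2.2 = 3 ∧ (k.1.1.val = 0 ∨ k.1.1.val = N) := fun k => by
    rw [hshdef, Finset.mem_filter]; simp
  set pos : Finset ((ZMod (2 * N) × ZMod N × ZMod N × ZMod N) × Fin 4 × Fin 4) :=
    Finset.univ.filter fun k =>
      (k.2.1 = 0 ∧ k.2.2 = 1 ∧ 1 ≤ k.1.1.val ∧ k.1.1.val + 1 ≤ N) ∨
      (k.2.1 = 0 ∧ (k.2.2 = 2 ∨ k.2.2 = 3) ∧ k.1.1.val + 1 ≤ N) ∨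
      (k.2.1 = 1 ∧ (k.2.2 = 2 ∨ k.2.2 = 3) ∧ 1 ≤ k.1.1.val ∧ k.1.1.val ≤ N) ∨
      (k.2.1 = 2 ∧ k.2.2 = 3 ∧ 1 ≤ k.1.1.val ∧ k.1.1.val + 1 ≤ N) with hposdef
  have hpos : ∀ k, k ∈ pos ↔
      (k.2.1 = 0 ∧ k.2.2 = 1 ∧ 1 ≤ k.1.1.val ∧ k.1.1.val + 1 ≤ N) ∨
      (k.2.1 = 0 ∧ (k.2.2 = 2 ∨ k.2.2 = 3) ∧ k.1.1.val + 1 ≤ N) ∨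
      (k.2.1 = 1 ∧ (k.2.2 = 2 ∨ k.2.2 = 3) ∧ 1 ≤ k.1.1.val ∧ k.1.1.val ≤ N) ∨
      (k.2.1 = 2 ∧ k.2.2 = 3 ∧ 1 ≤ k.1.1.val ∧ k.1.1.val + 1 ≤ N) := fun k => by
    rw [hposdef, Finset.mem_filter]; simp
  set cl : (ZMod (2 * N) × ZMod N × ZMod N × ZMod N) × Fin 4 × Fin 4 →
      ((ZMod (2 * N) × ZMod N × ZMod N × ZMod N) × Fin 4 → G) → G :=
    fun k U => if k.1.1 = 0 then U (k.1, 0) * U (k.1 + st 0, 1) else U (k.1, 1) * U (k.1 + st 1, 0) with hcl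
  set a : ((ZMod (2 * N) × ZMod N × ZMod N × ZMod N) × Fin 4 × Fin 4) × Fin Nc × Fin Nc × Bool →
      ((ZMod (2 * N) × ZMod N × ZMod N × ZMod N) × Fin 4 → G) → ℂ :=
    fun i U => if i.1 ∈ cut then (Real.sqrt (β / 2) : ℂ) *
      (if i.2.2.2 then conj (ρ (cl i.1 U) i.2.1 i.2.2.1) else ρ (cl i.1 U) i.2.1 i.2.2.1) else 0 with ha
  set g : ((ZMod (2 * N) × ZMod N × ZMod N × ZMod N) × Fin 4 → G) → ℂ :=
    fun U => F U * (Real.exp (β * ∑ k ∈ pos, (ρ (plaq U k.1 k.2.1 k.2.2)).trace.re +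
      β / 2 * ∑ k ∈ sh, (ρ (plaq U k.1 k.2.1 k.2.2)).trace.re) : ℂ) with hg
  exact integral_conj_comp_θ_mul_nonneg_aux hst hθs hθ rfl rfl hPos hM hP hlt hcut hsh hpos
    (neg := lt \ (cut ∪ sh ∪ pos)) rfl ρ hplaq hact hcl ha hg hN hρ hu hβ hF hFb hFdep

end Main

end TiltedTorusRP

end Literature.MathematicalPhysics.QuantumFieldTheory

end
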